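import Summits.CriticalPhenomena.CardyFormulaZ2.Theorems.CardyDualCurrentCanonicalLimitFromExactCRStubLimitHolomorphic

/-!
# Stub `stub_limitAntiHolomorphic` (crux stmt-CriticalPhenomena-11394, line `registered`)

The companion of the Morera stub `stub_limitHolomorphic`: under the same hypotheses (a local
parafermionic template `T` exactly Cauchy–Riemann in the discrete domains `E δ_k` of a
`ZdDiscretisationFamily` along meshes `δ_k → 0⁺`, renormalised step functions
`c_k · T.obs (E δ_k) ⌊w/δ_k⌋ i → g i` uniformly on compacts, `g i` continuous), the DIFFERENCE of
the two edge-type limits is ANTI-holomorphic: `w ↦ conj (g 0 w - g 1 w)` is holomorphic on `D`.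

Proof: the class of exactly-CR templates is stable under the **conjugate-staggering**
`T ↦ T†` (spins `s ↦ -s`, local weights `g ↦ conj g` on horizontal and `g ↦ -conj g` on vertical
edges), whose observable is `conj (T.obs)` on horizontal and `-conj (T.obs)` on vertical edges
(`obs_conjStagger_zero/one`: `passageSum` at spin `-s` is the conjugate, `integral_conj`); the
discrete Cauchy–Riemann system `V(v) - V(v - e₁) = i (H(v) - H(v - e₀))`,
`H(f + e₁) - H(f) = i (V(f + e₀) - V(f))` is invariant under `(H, V) ↦ (conj H, -conj V)`
(`isExactCRIn_conjStagger`). The Morera stub applied to `T†` with normalisers `conj c_k` gives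
holomorphy of `conj g₀ + (-conj g₁) = conj (g₀ - g₁)`.

Consequence recorded for the planners (lead finding F3): exact CR alone constrains a subsequential
limit pair `(g₀, g₁)` only to "`g₀ + g₁` holomorphic, `g₀ - g₁` anti-holomorphic"; the crux needs
`g₀ = g₁ = q`, i.e. the vanishing of the staggered (anti-holomorphic) component and the
Riemann–Hilbert boundary values of the holomorphic one — information the CR clause does not carry.
-/

noncomputable section

namespace Summit.CriticalPhenomena.CardyFormulaZ2.Cruxes.CanonicalLimitFromExactCR.Birth

open scoped BigOperators Topology ComplexConjugate
open Filter Set Metric Complex MeasureTheory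
open Literature.Probability.LatticeModels Literature.Probability.RandomPlanarGeometry

namespace AntiHolomorphic

/-! ### Conjugate-staggering of a template -/

/-- The **conjugate-staggered template** `T†`: same range, passage vertices and number of terms;
spins negated; local weights conjugated on horizontal edges and minus-conjugated on vertical edges.
[folklore] -/
def conjStagger (T : LocalParafermionicTemplate) : LocalParafermionicTemplate where
  r := T.r
  m := T.m
  z := T.z
  s := fun i k => -(T.s i k)
  g := fun i k P => if i = 0 then conj (T.g i k P) else -(conj (T.g i k P))
  dist_le := T.dist_le

/-- The passage sum at spin `-s` is the conjugate of the passage sum at spin `s` (the windings are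
real). [folklore] -/
theorem passageSum_neg (γ : List MedialVertex) (δ s : ℝ) (z : MedialVertex) :
    passageSum γ δ (-s) z = conj (passageSum γ δ s z) := by
  unfold passageSum
  rw [map_sum]
  refine Finset.sum_congr rfl fun k _ => ?_
  rw [← Complex.exp_conj]
  congr 1
  simp only [map_mul, map_neg, Complex.conj_I, Complex.conj_ofReal]
  push_cast
  ring

/-- Horizontal observable of `T†`: the conjugate of that of `T`. [folklore] -/
theorem obs_conjStagger_zero (T : LocalParafermionicTemplate) (Dd : DiscreteDobrushin) (x : Site 2) :
    (conjStagger T).obs Dd x 0 = conj (T.obs Dd x 0) := by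
  rw [LocalParafermionicTemplate.obs_eq, LocalParafermionicTemplate.obs_eq, ← integral_conj]
  refine integral_congr_ae (Eventually.of_forall fun ω => ?_)
  simp only [conjStagger, Fin.isValue, ↓reduceIte, map_sum, map_mul]
  exact Finset.sum_congr rfl fun k _ => by rw [passageSum_neg]

/-- Vertical observable of `T†`: minus the conjugate of that of `T`. [folklore] -/
theorem obs_conjStagger_one (T : LocalParafermionicTemplate) (Dd : DiscreteDobrushin) (x : Site 2) :
    (conjStagger T).obs Dd x 1 = -conj (T.obs Dd x 1) := by
  rw [LocalParafermionicTemplate.obs_eq, LocalParafermionicTemplate.obs_eq, ← integral_conj,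
    ← integral_neg]
  refine integral_congr_ae (Eventually.of_forall fun ω => ?_)
  simp only [conjStagger, Fin.isValue, one_ne_zero, ↓reduceIte, map_sum, map_mul, neg_mul,
    Finset.sum_neg_distrib]
  congr 1
  exact Finset.sum_congr rfl fun k _ => by rw [passageSum_neg]

/-- **Exact CR is invariant under conjugate-staggering.** [folklore] -/
theorem isExactCRIn_conjStagger {T : LocalParafermionicTemplate} {Dd : DiscreteDobrushin}
    (h : T.IsExactCRIn Dd) : (conjStagger T).IsExactCRIn Dd := by
  constructor
  · intro x h0 h1 h2 h3
    have key := h.1 x h0 h1 h2 h3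
    rw [obs_conjStagger_one, obs_conjStagger_one, obs_conjStagger_zero, obs_conjStagger_zero,
      ← map_sub, show -conj (T.obs Dd x 1) - -conj (T.obs Dd (x - Pi.single 1 1) 1) =
        -conj (T.obs Dd x 1 - T.obs Dd (x - Pi.single 1 1) 1) by rw [map_sub]; ring, key, map_mul,
      Complex.conj_I]
    ring
  · intro f h0 h1 h2 h3
    have key := h.2 f h0 h1 h2 h3
    rw [obs_conjStagger_one, obs_conjStagger_one, obs_conjStagger_zero, obs_conjStagger_zero,
      ← map_sub, key, map_mul, Complex.conj_I, map_sub]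
    ring

/-! ### The anti-holomorphic component -/

/-- **Subsequential limits of a renormalised exactly-CR template observable have
`g 0 - g 1` anti-holomorphic** (Morera for the conjugate-staggered template).
[cite: Smirnov2010, §5 (proof of Theorem 2.2, Morera step)] -/
theorem differentiableOn_conj_sub_of_limit (T : LocalParafermionicTemplate) {D : DobrushinDomain}
    {E : ℝ → DiscreteDobrushin} (hDE : ZdDiscretisationFamily D E) {s : ℕ → ℝ}
    (hs : Tendsto s atTop (𝓝[>] (0 : ℝ))) (hCR : ∀ᶠ k in atTop, T.IsExactCRIn (E (s k)))
    (c : ℕ → ℂ) {g : Fin 2 → ℂ → ℂ} (hg : ∀ i, ContinuousOn (g i) D.carrier)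
    (hconv : ∀ (i : Fin 2) (K : Set ℂ), K ⊆ D.carrier → IsCompact K →
      TendstoUniformlyOn (fun (k : ℕ) (w : ℂ) => c k *
        T.obs (E (s k)) (fun j => ⌊(if j = 0 then w.re else w.im) / s k⌋) i) (g i) atTop K) :
    DifferentiableOn ℂ (fun w => conj (g 0 w - g 1 w)) D.carrier := by
  set G : Fin 2 → ℂ → ℂ := fun i w => if i = 0 then conj (g 0 w) else -conj (g 1 w) with hG
  have hconj : UniformContinuous (conj : ℂ → ℂ) := Complex.isometry_conj.uniformContinuous
  have hnegconj : UniformContinuous (fun z : ℂ => -conj z) := uniformContinuous_neg.comp hconj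
  have hGc : ∀ i, ContinuousOn (G i) D.carrier := by
    intro i
    fin_cases i
    · simp only [hG, Fin.zero_eta, Fin.isValue, ↓reduceIte]
      exact Complex.continuous_conj.comp_continuousOn (hg 0)
    · simp only [hG, Fin.mk_one, Fin.isValue, one_ne_zero, ↓reduceIte]
      exact (Complex.continuous_conj.comp_continuousOn (hg 1)).neg
  have hGconv : ∀ (i : Fin 2) (K : Set ℂ), K ⊆ D.carrier → IsCompact K →
      TendstoUniformlyOn (fun (k : ℕ) (w : ℂ) => conj (c k) *
        (conjStagger T).obs (E (s k)) (fun j => ⌊(if j = 0 then w.re else w.im) / s k⌋) i)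
        (G i) atTop K := by
    intro i K hKD hK
    fin_cases i
    · have h := hconj.comp_tendstoUniformlyOn (hconv 0 K hKD hK)
      refine (h.congr (Eventually.of_forall fun k w _ => ?_)).congr_right fun w _ => ?_
      · simp only [Fin.zero_eta, Function.comp_apply, map_mul, obs_conjStagger_zero]
      · simp [hG]
    · have h := hnegconj.comp_tendstoUniformlyOn (hconv 1 K hKD hK)
      refine (h.congr (Eventually.of_forall fun k w _ => ?_)).congr_right fun w _ => ?_
      · simp only [Fin.mk_one, Function.comp_apply, map_mul, obs_conjStagger_one, mul_neg]
      · simp [hG]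
  have key := LimitHolomorphic.differentiableOn_add_of_limit (conjStagger T) hDE hs
    (hCR.mono fun k hk => isExactCRIn_conjStagger hk) (fun k => conj (c k)) hGc hGconv
  refine key.congr fun w _ => ?_
  simp only [hG, Fin.isValue, ↓reduceIte, one_ne_zero, map_sub]
  ring

end AntiHolomorphic

/-! ### The registered stub -/

/-- stub `stub_limitAntiHolomorphic` (anti-Morera step for templates, via conjugate-staggering):
for every local parafermionic template `T`, every Dobrushin domain `D`, every
`ZdDiscretisationFamily E` of `D`, every sequence of meshes `s k → 0⁺` along which `T` is exactly
Cauchy–Riemann in `E (s k)` (eventually), every normalisers `c k` and continuous `g 0, g 1` on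
`D`: if `c k · T.obs (E (s k)) ⌊w / s k⌋ i → g i` uniformly on compacts of `D` (`i = 0, 1`), then
`conj (g 0 - g 1)` is holomorphic on `D` (the staggered component of the limit is
anti-holomorphic). -/
theorem stub_limitAntiHolomorphic :
    (∀ (T : Literature.Probability.LatticeModels.LocalParafermionicTemplate) (D : Literature.Probability.RandomPlanarGeometry.DobrushinDomain) (E : ℝ → Literature.Probability.LatticeModels.DiscreteDobrushin), Literature.Probability.LatticeModels.ZdDiscretisationFamily D E → ∀ (s : ℕ → ℝ), Filter.Tendsto s Filter.atTop (𝓝[>] (0 : ℝ)) → (∀ᶠ k in Filter.atTop, T.IsExactCRIn (E (s k))) → ∀ (c : ℕ → ℂ) (g : Fin 2 → ℂ → ℂ), (∀ i, ContinuousOn (g i) D.carrier) → (∀ (i : Fin 2) (K : Set ℂ), K ⊆ D.carrier → IsCompact K → TendstoUniformlyOn (fun (k : ℕ) (w : ℂ) => c k * T.obs (E (s k)) (fun j => ⌊(if j = 0 then w.re else w.im) / s k⌋) i) (g i) Filter.atTop K) → DifferentiableOn ℂ (fun w => (starRingEnd ℂ) (g 0 w - g 1 w)) D.carrier) := by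
  intro T D E hDE s hs hCR c g hg hconv
  exact AntiHolomorphic.differentiableOn_conj_sub_of_limit T hDE hs hCR c hg hconv

end Summit.CriticalPhenomena.CardyFormulaZ2.Cruxes.CanonicalLimitFromExactCR.Birth

end
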